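import Literature.AlgebraicGeometry.Frobenioids.ArchimedeanDilationEquivalenceRelative
import Literature.IUT.HodgeTheaters.LocalFrobenioidsArchModel
import Literature.IUT.HodgeTheaters.LocalFrobenioidsWitness
import Literature.IUT.HodgeTheaters.Cor53iiiAtArchPlace
import HarnessLib

/-!
# [IUTchI] Cor 5.3 (iii) at `v̲ ∈ 𝕍^arc` — CONTENT ENRICHMENT (R84 «ARCHDIL»): every DILATION `D_μ` of the `𝕋𝕄⊢`-object `(𝒪^▷(𝒞⊢_v̲), τ⊢_v̲)` is
# induced by a `τ⊢`-compatible self-equivalence `Ψ_μ` of the GENUINE archimedean Frobenioid `𝒞⊢_v̲ = 𝒞_v̲` (`ArchLocalFrobenioid.ofArchFrd`)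

S. Mochizuki, *Inter-universal Teichmüller theory I: construction of Hodge theaters*, Publ. RIMS Kyoto Univ. **57** (2021) 3–207, kurims text.
Ex. 3.4 (ii) p. 81: the category `𝕋𝕄⊢` «whose morphisms `(C₁, C₁→) → (C₂, C₂→)` are isomorphisms of topological monoids `C₁ ⥲ C₂` that induce
isomorphisms `C₁→ ⥲ C₂→`», and «we may think of the pair `(𝒪^▷(𝒞⊢_v), τ⊢_v)` as the object of `𝕋𝕄⊢` determined by `K_v`»; Ex. 3.4 (i) p. 80: «by
construction, there is a natural isomorphism `𝒪^▷(𝒞_v) ⥲ 𝒪^▷_{K_v}` of topological monoids» [cite: Mochizuki2012, Ex 3.4 (i) p.80];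
Cor. 5.3 (iii) p. 144 l. 16–19: «`Isom(¹𝔉⊢, ²𝔉⊢) → Isom(¹𝔇⊢, ²𝔇⊢)` […] is surjective» [cite: Mochizuki2012, Cor 5.3 (iii) p.144];
S. Mochizuki, *Topics in absolute anabelian geometry III*, Rmk 5.8.1 (i) p. 142: the mono-analytic object of `𝕋𝕄⊢` is «non-rigid, in the sense that
it is subject to dilations» [cite: MochizukiAbsTopIII2015, Remark 5.8.1 p.142].  [claim: Mochizuki2012, status: disputed]

## What this file proves (abc-iut cell, row R84 (T2-iii), abc-iut-L5-t16; PROOF-ONLY; consumer of abc-iut-L1's [FrdII]-side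
## `ArchimedeanDilationEquivalence(Relative)` at abc-iut-L5-t2's GENUINE model `ArchLocalFrobenioid.ofArchFrd`)

Print's arch `⊢`-slot of Cor 5.3 (iii) is, AS PRINTED, the decoupled statement of abc-iut-L5-t4's `Cor53iiiAtArchPlace` (the `𝕋𝕄⊢` constituent of an
`ℱ⊢`-prime-strip is a separate datum).  THIS file supplies the CONTENT behind print's identification «think of `(𝒪^▷(𝒞⊢_v), τ⊢_v)` as the object of
`𝕋𝕄⊢` determined by `K_v`» for the DILATION class of `𝕋𝕄⊢`-automorphisms (OURS — print records only «subject to dilations»):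
* §1 `Cor53iii.continuous_unitDisc_dilate`, `Cor53iii.exists_splitTopMonoidHom_dilate μ`: `D_μ : z ↦ z·|z|^{μ-1}` is continuous on `𝒪^▷_ℂ` and IS a
  `𝕋𝕄⊢`-automorphism of the model object `(𝒪^▷_ℂ, (0,1])` (abc-iut-L5-t2's `SplitTopMonoid.ofComplex`), non-identity for `μ ≠ 1`
  (`exists_splitTopMonoidHom_dilate_ne_refl`);
* §2 **`Cor53iii.exists_archDilationLift μ`**: for `X := ArchLocalFrobenioid.ofArchFrd` (`𝒞_v := ArchFrd.Cpt`, `𝒪^▷(𝒞_v) := 𝒪^▷(std 1)`,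
  `isoOK = ArchFrd.Cpt.endEquivUnitDisc 1`) there are a self-EQUIVALENCE `Ψ` of `X.Cv` — the dilation functor `ArchFrd.C.dilateFunctor ptBase μ` of
  ★ `ArchimedeanDilationEquivalenceRelative` — and a bicontinuous automorphism `θ` of the topological monoid `X.OC` such that `θ` IS `Ψ` on
  base-identity linear endomorphisms (`HEq` up to the retyping `Ψ (std 1) = std 1`), `X.isoOK ∘ θ = D_μ ∘ X.isoOK`, and `θ` carries `τ⊢_v = X.tauDash`
  onto itself;
* §3 `Cor53iii.splitTopMonoidHom_dilate_isInduced`: hence every `𝕋𝕄⊢`-automorphism of `(𝒪^▷_ℂ, (0,1])` that is a dilation is induced, through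
  print's `𝒪^▷(𝒞_v) ⥲ 𝒪^▷_{K_v}`, by a `τ⊢`-compatible self-equivalence of `𝒞⊢_v`;
* §4 `Cor53iii.exists_archDashTripleIso_model_dilate μ`: in the language of the ARCH `⊢`-slot of record (abc-iut-L5-t4's ★ `Cor53iiiAtArchPlace`:
  `ArchDashTriple.Iso`, `Iso.toDash`), the dilation `D_μ` of the model's `𝒟⊢`-constituent has a preimage under `toDash` whose `𝒞⊢`- and
  `𝒪^▷`-components are COHERENT — `isoC = Ψ_μ` and `isoOC = Ψ_μ` on `𝒪^▷(std 1)` — upgrading `arch_dashLiftsAll` («some preimage») to «an INDUCED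
  preimage» on the dilation class.
Census: binders `μ : ℝ_{>0}` (+ `f`, `hf` in §3) · LAW ∅ · FACT ∅ · side ∅ · 0 def · 0 instance · 0 notation (6 theorems, PROOF-ONLY).  Honest label: OUR theorem about OUR
model; NOT a precondition of the print-faithful (iii)-slot; the conjugation class (`ε = conj`) is not treated here.  Nothing here concerns
[IUTchIII] Cor. 3.12; no side is taken on any disputed claim.
-/

noncomputable section

namespace Literature.IUT.HodgeTheaters

open CategoryTheory Literature.AlgebraicGeometry.Frobenioids

namespace Cor53iii

/-! ### §1. `D_μ` is a `𝕋𝕄⊢`-automorphism of the model object `(𝒪^▷_ℂ, (0, 1])` -/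

/-- **`D_μ : z ↦ z·(|z|⁻¹·|z|^μ)` is CONTINUOUS on `𝒪^▷_ℂ`** (topology induced from `ℂ`). [cite: MochizukiAbsTopIII2015, Remark 5.8.1 p.142]
[claim: Mochizuki2012, status: disputed] -/
theorem continuous_unitDisc_dilate (μ : ArchFrd.PosReal) : Continuous (ArchFrd.unitDisc.dilate μ) := by
  refine continuous_induced_rng.2 ?_
  have h : (Subtype.val ∘ ArchFrd.unitDisc.dilate μ) = fun z : ArchFrd.unitDisc => (z : ℂ) * (((‖(z : ℂ)‖⁻¹ * ‖(z : ℂ)‖ ^ (μ : ℝ) : ℝ)) : ℂ) := by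
    funext z
    rw [Function.comp_apply, ArchFrd.unitDisc.coe_dilate, ArchFrd.dilate_eq_mul_ofPosReal, Units.val_mul, Units.val_mk0, ArchFrd.coe_ofPosReal]
    rfl
  rw [h]
  exact continuous_subtype_val.mul (Complex.continuous_ofReal.comp
    ((continuous_subtype_val.norm.inv₀ fun z => norm_ne_zero_iff.2 (ArchFrd.mem_unitDisc.1 z.2).1).mul
      (continuous_subtype_val.norm.rpow_const fun z => Or.inl (norm_ne_zero_iff.2 (ArchFrd.mem_unitDisc.1 z.2).1))))

/-- **`D_μ` as a morphism `(𝒪^▷_ℂ, (0,1]) → (𝒪^▷_ℂ, (0,1])` of `𝕋𝕄⊢`** (a bicontinuous automorphism of the topological monoid `𝒪^▷_ℂ`, inverse `D_{1/μ}`,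
carrying `(0,1]` onto itself: `r ↦ r^μ`). [cite: Mochizuki2012, Ex 3.4 (i) p.80] [claim: Mochizuki2012, status: disputed] -/
theorem exists_splitTopMonoidHom_dilate (μ : ArchFrd.PosReal) :
    ∃ f : SplitTopMonoid.Hom SplitTopMonoid.ofComplex SplitTopMonoid.ofComplex, ∀ z, f.iso z = ArchFrd.unitDisc.dilate μ z := by
  let e : ArchFrd.unitDisc ≃* ArchFrd.unitDisc :=
    { ArchFrd.unitDisc.dilate μ with
      invFun := ArchFrd.unitDisc.dilate μ⁻¹
      left_inv := ArchFrd.unitDisc.dilate_inv_dilate μ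
      right_inv := ArchFrd.unitDisc.dilate_dilate_inv μ }
  refine ⟨{ iso := e
            continuous := continuous_unitDisc_dilate μ
            continuous_symm := continuous_unitDisc_dilate μ⁻¹
            map_vec := ?_ }, fun z => rfl⟩
  ext z
  constructor
  · rintro ⟨y, hy, rfl⟩
    exact (ArchFrd.unitDisc.dilate_mem_posReal_iff μ y).2 hy
  · intro hz
    refine ⟨ArchFrd.unitDisc.dilate μ⁻¹ z, ?_, ?_⟩
    · have hz' : ∃ r : ℝ, 0 < r ∧ r ≤ 1 ∧ ((ArchFrd.unitDisc.dilate μ (ArchFrd.unitDisc.dilate μ⁻¹ z) : ArchFrd.unitDisc) : ℂ) = (r : ℂ) := by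
        rw [ArchFrd.unitDisc.dilate_dilate_inv]; exact hz
      exact (ArchFrd.unitDisc.dilate_mem_posReal_iff μ _).1 hz'
    · exact ArchFrd.unitDisc.dilate_dilate_inv μ z

/-- For `μ ≠ 1`, `D_μ` is NOT the identity of `(𝒪^▷_ℂ, (0,1])` (it moves `1/2`). [cite: Mochizuki2012, Ex 3.4 (i) p.80]
[claim: Mochizuki2012, status: disputed] -/
theorem exists_splitTopMonoidHom_dilate_ne_refl (μ : ArchFrd.PosReal) (hμ : μ ≠ 1) :
    ∃ f : SplitTopMonoid.Hom SplitTopMonoid.ofComplex SplitTopMonoid.ofComplex,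
      (∀ z, f.iso z = ArchFrd.unitDisc.dilate μ z) ∧ f.iso ≠ MulEquiv.refl _ := by
  obtain ⟨f, hf⟩ := exists_splitTopMonoidHom_dilate μ
  refine ⟨f, hf, fun h => hμ ?_⟩
  have hhalf : ((1 / 2 : ℝ) : ℂ) ∈ unitDiscMonoid ℂ := by
    refine ⟨by norm_num, ?_⟩
    rw [Complex.norm_real, Real.norm_of_nonneg (by norm_num)]; norm_num
  have h0 : ArchFrd.unitDisc.dilate μ ⟨_, hhalf⟩ = ⟨_, hhalf⟩ := by
    have h0' := MulEquiv.congr_fun h ⟨_, hhalf⟩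
    rw [hf] at h0'
    exact h0'
  have h1' : (((1 / 2 : ℝ) ^ (μ : ℝ) : ℝ) : ℂ) = ((1 / 2 : ℝ) : ℂ) := by
    rw [← ArchFrd.unitDisc.coe_dilate_of_pos μ ⟨_, hhalf⟩ (r := 1 / 2) (by norm_num) rfl, h0]
  have h1 : (1 / 2 : ℝ) ^ (μ : ℝ) = 1 / 2 := Complex.ofReal_injective h1'
  -- `(1/2)^μ = 1/2` forces `μ = 1`
  have hμ1 : (μ : ℝ) = 1 := by
    have h2 : (1 / 2 : ℝ) ^ (μ : ℝ) = (1 / 2 : ℝ) ^ (1 : ℝ) := by rw [h1, Real.rpow_one]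
    have hle := (Real.rpow_le_rpow_left_iff_of_base_lt_one (by norm_num : (0 : ℝ) < 1 / 2) (by norm_num : (1 / 2 : ℝ) < 1)).1 h2.le
    have hge := (Real.rpow_le_rpow_left_iff_of_base_lt_one (by norm_num : (0 : ℝ) < 1 / 2) (by norm_num : (1 / 2 : ℝ) < 1)).1 h2.ge
    exact le_antisymm hge hle
  exact Subtype.ext hμ1

/-! ### §2. The dilation lift at the GENUINE archimedean Frobenioid `𝒞_v` -/

/-- **[IUTchI] Cor 5.3 (iii), ARCH `⊢`-slot, DILATION CONTENT (OURS).**  For `X := ArchLocalFrobenioid.ofArchFrd` and every `μ > 0` there are a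
self-equivalence `Ψ` of `𝒞⊢_v = 𝒞_v` (the dilation functor `Ψ_μ`) and a bicontinuous automorphism `θ` of the topological monoid `𝒪^▷(𝒞⊢_v)` such that:
`θ` IS `Ψ` on base-identity linear endomorphisms of the pseudo-terminal object `std 1` (up to the retyping `Ψ (std 1) = std 1`); through print's
`𝒪^▷(𝒞_v) ⥲ 𝒪^▷_{K_v}` (`X.isoOK`), `θ` is the dilation `D_μ`; and `θ` carries the splitting `τ⊢_v` onto itself — i.e. `θ : (𝒪^▷(𝒞⊢_v), τ⊢_v) ⥲
(𝒪^▷(𝒞⊢_v), τ⊢_v)` is a `𝕋𝕄⊢`-automorphism INDUCED BY `Ψ`. [cite: Mochizuki2012, Cor 5.3 (iii) p.144] [claim: Mochizuki2012, status: disputed] -/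
theorem exists_archDilationLift (μ : ArchFrd.PosReal) :
    ∃ (Ψ : ArchLocalFrobenioid.ofArchFrd.Cv ≌ ArchLocalFrobenioid.ofArchFrd.Cv)
      (θ : ArchLocalFrobenioid.ofArchFrd.OC ≃* ArchLocalFrobenioid.ofArchFrd.OC),
      Ψ.functor = ArchFrd.C.dilateFunctor ArchFrd.ptBase μ ∧
      (∀ φ : ArchLocalFrobenioid.ofArchFrd.OC, HEq (θ φ).1 (Ψ.functor.map φ.1)) ∧
      (Continuous θ ∧ Continuous θ.symm) ∧
      (∀ φ : ArchLocalFrobenioid.ofArchFrd.OC,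
        ArchLocalFrobenioid.ofArchFrd.isoOK (θ φ) = ArchFrd.unitDisc.dilate μ (ArchLocalFrobenioid.ofArchFrd.isoOK φ)) ∧
      ArchLocalFrobenioid.ofArchFrd.tauDash.map θ.toMonoidHom = ArchLocalFrobenioid.ofArchFrd.tauDash := by
  haveI := ArchFrd.C.dilateFunctor_isEquivalence ArchFrd.ptBase μ
  let θ : ArchLocalFrobenioid.ofArchFrd.OC ≃* ArchLocalFrobenioid.ofArchFrd.OC := ArchFrd.Cpt.dilateEndOneEquiv μ
  have hiso : ∀ φ : ArchLocalFrobenioid.ofArchFrd.OC,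
      ArchLocalFrobenioid.ofArchFrd.isoOK (θ φ) = ArchFrd.unitDisc.dilate μ (ArchLocalFrobenioid.ofArchFrd.isoOK φ) :=
    fun φ => ArchFrd.Cpt.endEquivUnitDisc_dilateEndOne μ φ
  have hiso' : ∀ ψ : ArchLocalFrobenioid.ofArchFrd.OC,
      ArchLocalFrobenioid.ofArchFrd.isoOK (θ.symm ψ) = ArchFrd.unitDisc.dilate μ⁻¹ (ArchLocalFrobenioid.ofArchFrd.isoOK ψ) := by
    intro ψ
    have h := hiso (θ.symm ψ)
    rw [MulEquiv.apply_symm_apply] at h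
    rw [h, ArchFrd.unitDisc.dilate_inv_dilate]
  refine ⟨(ArchFrd.C.dilateFunctor ArchFrd.ptBase μ).asEquivalence, θ, rfl, fun φ => ArchFrd.Cpt.heq_coe_dilateEndOne μ φ, ⟨?_, ?_⟩, hiso, ?_⟩
  · -- continuity: the topology of `𝒪^▷(std 1)` is induced along the scalar, and scalar ∘ θ = D_μ ∘ scalar
    refine continuous_induced_rng.2 ?_
    refine Continuous.congr
      (continuous_subtype_val.comp ((continuous_unitDisc_dilate μ).comp (ArchFrd.Cpt.continuous_endEquivUnitDisc 1))) ?_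
    intro φ
    exact (congrArg Subtype.val (hiso φ)).symm
  · refine continuous_induced_rng.2 ?_
    refine Continuous.congr
      (continuous_subtype_val.comp ((continuous_unitDisc_dilate μ⁻¹).comp (ArchFrd.Cpt.continuous_endEquivUnitDisc 1))) ?_
    intro ψ
    exact (congrArg Subtype.val (hiso' ψ)).symm
  · -- `τ⊢ ↦ τ⊢`: membership is read through `isoOK`, where `θ` is `D_μ`, which carries `(0,1]` onto itself
    ext φ
    rw [Submonoid.mem_map_equiv]
    change (∃ r : ℝ, 0 < r ∧ r ≤ 1 ∧ ((ArchLocalFrobenioid.ofArchFrd.isoOK (θ.symm φ) : unitDiscMonoid ℂ) : ℂ) = (r : ℂ)) ↔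
      (∃ r : ℝ, 0 < r ∧ r ≤ 1 ∧ ((ArchLocalFrobenioid.ofArchFrd.isoOK φ : unitDiscMonoid ℂ) : ℂ) = (r : ℂ))
    rw [hiso']
    exact ArchFrd.unitDisc.dilate_mem_posReal_iff μ⁻¹ _

/-! ### §3. Every dilation in `𝕋𝕄⊢` is induced by a self-equivalence of `𝒞⊢_v` -/

/-- **Every `𝕋𝕄⊢`-automorphism of `(𝒪^▷_ℂ, (0,1])` that is a dilation `D_μ` is INDUCED — through print's `𝒪^▷(𝒞_v) ⥲ 𝒪^▷_{K_v}` — by a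
`τ⊢`-compatible self-equivalence of the genuine `𝒞⊢_v`** (OURS; the content of [AbsTopIII] Rmk 5.8.1 (i)'s «subject to dilations» at the level of
the Frobenioid). [cite: MochizukiAbsTopIII2015, Remark 5.8.1 p.142] [claim: Mochizuki2012, status: disputed] -/
theorem splitTopMonoidHom_dilate_isInduced (μ : ArchFrd.PosReal) (f : SplitTopMonoid.Hom SplitTopMonoid.ofComplex SplitTopMonoid.ofComplex)
    (hf : ∀ z, f.iso z = ArchFrd.unitDisc.dilate μ z) :
    ∃ (Ψ : ArchLocalFrobenioid.ofArchFrd.Cv ≌ ArchLocalFrobenioid.ofArchFrd.Cv)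
      (θ : ArchLocalFrobenioid.ofArchFrd.OC ≃* ArchLocalFrobenioid.ofArchFrd.OC),
      (∀ φ : ArchLocalFrobenioid.ofArchFrd.OC, HEq (θ φ).1 (Ψ.functor.map φ.1)) ∧
      (Continuous θ ∧ Continuous θ.symm) ∧
      (∀ φ : ArchLocalFrobenioid.ofArchFrd.OC, ArchLocalFrobenioid.ofArchFrd.isoOK (θ φ) = f.iso (ArchLocalFrobenioid.ofArchFrd.isoOK φ)) ∧
      ArchLocalFrobenioid.ofArchFrd.tauDash.map θ.toMonoidHom = ArchLocalFrobenioid.ofArchFrd.tauDash := by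
  obtain ⟨Ψ, θ, -, hheq, hcont, hiso, htau⟩ := exists_archDilationLift μ
  exact ⟨Ψ, θ, hheq, hcont, fun φ => (hiso φ).trans (hf _).symm, htau⟩

/-! ### §4. In the language of the ARCH `⊢`-slot of record: an INDUCED preimage of `D_μ` under `Iso.toDash` -/

/-- **R84 knitted into the slot of record.**  For the MODEL archimedean `ℱ⊢`-datum (abc-iut-L5-t4's `ArchDashTriple.model` = `(𝒞_v, (𝒪^▷(𝒞_v), τ⊢_v),
(𝒪^▷_ℂ, (0,1]))` at `ArchLocalFrobenioid.ofArchFrd`) and every `μ > 0` there is an automorphism of triples `f` (Def 5.2 (iii)) whose `𝒟⊢`-component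
`f.toDash` is the dilation `D_μ`, whose `𝒞⊢`-component is the dilation self-equivalence `Ψ_μ`, and whose `𝒪^▷`-component IS `Ψ_μ` on base-identity linear
endomorphisms and is read through `isoOK` as `f.toDash` — i.e. on the dilation class the preimage under the (surjective, ★ `arch_dashLiftsAll`) natural map
`Isom(¹𝔉⊢, ²𝔉⊢) → Isom(¹𝔇⊢, ²𝔇⊢)` can be taken INDUCED by a self-equivalence of `𝒞⊢_v` (OURS; print: «subject to dilations»).
[cite: Mochizuki2012, Cor 5.3 (iii) p.144] [claim: Mochizuki2012, status: disputed] -/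
theorem exists_archDashTripleIso_model_dilate (μ : ArchFrd.PosReal) :
    ∃ f : ArchDashTriple.Iso ArchDashTriple.model ArchDashTriple.model,
      f.isoC.functor = ArchFrd.C.dilateFunctor ArchFrd.ptBase μ ∧
      (∀ φ : ArchLocalFrobenioid.ofArchFrd.OC, HEq (f.isoOC φ).1 (f.isoC.functor.map φ.1)) ∧
      (∀ φ : ArchLocalFrobenioid.ofArchFrd.OC, ArchLocalFrobenioid.ofArchFrd.isoOK (f.isoOC φ) = f.toDash.iso (ArchLocalFrobenioid.ofArchFrd.isoOK φ)) ∧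
      ∀ z, f.toDash.iso z = ArchFrd.unitDisc.dilate μ z := by
  obtain ⟨Ψ, θ, hΨ, hheq, ⟨hc, hc'⟩, hiso, htau⟩ := exists_archDilationLift μ
  obtain ⟨g, hg⟩ := exists_splitTopMonoidHom_dilate μ
  exact ⟨{ isoC := Ψ
           isoOC := θ
           continuous := hc
           continuous_symm := hc'
           map_tau := htau
           isoM := g }, hΨ, hheq, fun φ => (hiso φ).trans (hg _).symm, hg⟩

end Cor53iii

end Literature.IUT.HodgeTheaters
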